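import Summits.BirchSwinnertonDyer.BirchSwinnertonDyer.Theses.LeadingTerm
import Summits.BirchSwinnertonDyer.BirchSwinnertonDyer.Theorems.LeadingTermPinchPrimeCofiniteIMC
import Summits.BirchSwinnertonDyer.BirchSwinnertonDyer.Theorems.LeadingTermPinchPrimeCofiniteTorsion
import Summits.BirchSwinnertonDyer.BirchSwinnertonDyer.Theorems.LeadingTermPinchPrimeSemisimpleOrder
import Literature.NumberTheory.EllipticCurves.IwasawaSelmerDualProofs
import Literature.NumberTheory.EllipticCurves.SelmerInftyTorsionFiniteProofs
import Literature.NumberTheory.EllipticCurves.CanonicalPAdicHeightHolds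

/-!
# BirchSwinnertonDyer / LeadingTerm — crux `PinchPrime` (stmt-BirchSwinnertonDyer-16218),
# line `SketchIdeator2`, stub `stub_pinchAt_of_openStubs` (the line's COMPOSITION as a landed
# conditional bridge: named facts ∧ the two OPEN stubs ⟹ the `∃ p`-body of the crux, every `W`)

Registered stub of the lead skeleton `Cruxes/PinchPrime/Lines/SketchIdeator2.lean` (v9). It is
the composition `PinchPrime_of` of the line with its inputs made explicit, so that the line's
result is an importable, sorry-free theorem independently of the fate of the two open stubs:

* HYPOTHESES (named tree facts, unproved in the tree): modularity `exists_isNewformOf`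
  (BCDT 2001), the cyclotomic main conjecture in `Λ ⊗ ℚ_p` under irreducibility
  `burungale_castella_skinner_charIdeal_eq_padicLFunction` (Burungale–Castella–Skinner 2025,
  Thm. 1.1.2 (a)), Mazur's control theorem in corank form
  `Greenberg1999_coinvariantsRank_eq_selmerCorank_rat` (Greenberg, LNM 1716, Thm. 1.2);
* HYPOTHESES (the line's two OPEN stubs, inline): (A) for every elliptic `E/ℚ` (globally
  minimal `W`), `Ш(E/ℚ)[p^∞]` is finite for every good ordinary `p` outside a finite set
  (⊂ finiteness of `Ш`); (B) for every such `W`, outside every finite set there is a good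
  ordinary `p ≥ 5` with a cyclotomic `ℤ_p`-extension `κ` and a normalised topological generator
  `γ` such that multiplication by `T = γ - 1` is semisimple at `0` on `ℚ_p ⊗ X(E/ℚ_∞)`
  (`ker T² = ker T`) for every Iwasawa datum (Greenberg, LNM 1716, §1 Conj. 1.12 at `T = 0`,
  infinitely often; by `Theorems/LeadingTermPinchPrimeSemisimpleIffSchneiderInfinitelyOften`, given
  (A) it is Schneider non-degeneracy at infinitely many good ordinary primes);
* CONCLUSION: the `∃ p`-body of `LeadingTerm.PinchPrime` for every `W` (definitionally the crux).

Composition (all glue LANDED): pick the semisimple prime outside the three finite exceptional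
sets — `Ш` (A), IMC (`stub_cofiniteIMC`, p131521) and torsion (`stub_cofiniteTorsion`, p133139);
the Iwasawa datum exists (`nonempty_selmerDualData_holds`) and is finitely generated
(`module_finite_of_isCyclotomic`); `char X` is principal (`charIdeal_isPrincipal_holds`);
modularity gives `f`; torsion + semisimplicity + `Ш_p` finite + control give `ord_T f_E = rank`
(`stub_semisimpleOrder`, p133143); the cofinite IMC moves it to `ord_T L_p(f, α_p)`; the
canonical height datum is `exists_isCanonical_holds`.
-/

noncomputable section

set_option linter.dupNamespace false

namespace Summit.BirchSwinnertonDyer.BirchSwinnertonDyer.Cruxes.PinchPrime.FirstLayerStability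

open scoped MatrixGroups ModularForm
open CongruenceSubgroup Literature.NumberTheory.EllipticCurves
  Literature.NumberTheory.EllipticCurves.ModularForms
open Summit.BirchSwinnertonDyer.BirchSwinnertonDyer.Theses

/-- **The line `SketchIdeator2` as a conditional bridge** (stub `stub_pinchAt_of_openStubs` of
crux `PinchPrime`): modularity, BCS and the control fact, together with (A) cofinite finiteness
of `Ш[p^∞]` and (B) semisimplicity of `T` at `0` on `ℚ_p ⊗ X(E/ℚ_∞)` at infinitely many good
ordinary `p ≥ 5` with the normalised cyclotomic datum, imply for every elliptic `E/ℚ` (globally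
minimal `W`) the existence of a good ordinary `p ≥ 5`, a canonical height datum and a newform `f`
of `E` with `ord_{T=0} L_p(f, α_p, T) = rank_ℤ E(ℚ)` — the `W`-instance of the crux.
[cite: GreenbergLNM1716, Thm 1.2 and §1 Conj. 1.12] [cite: BurungaleCastellaSkinner2025, Thm. 1.1.2 (a)] -/
theorem stub_pinchAt_of_openStubs :
    exists_isNewformOf → burungale_castella_skinner_charIdeal_eq_padicLFunction →
    Greenberg1999_coinvariantsRank_eq_selmerCorank_rat →
    (∀ (W : WeierstrassCurve ℚ) [W.IsElliptic] [W.IsGloballyMinimal],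
      ∃ B : Finset ℕ, ∀ p ∉ B, ∀ [Fact p.Prime], IsOrdinaryAt W p →
        Finite (AddCommGroup.primaryComponent W.sha p)) →
    (∀ (W : WeierstrassCurve ℚ) [W.IsElliptic] [W.IsGloballyMinimal], ∀ B : Finset ℕ,
      ∃ p ∉ B, ∃ _ : Fact p.Prime, 5 ≤ p ∧ IsOrdinaryAt W p ∧
        ∃ (κ : ZpExtension ℚ p) (γ : Field.absoluteGaloisGroup ℚ),
          κ.IsCyclotomic ∧ κ.IsTopGenerator γ ∧ IsCyclotomicVariable p γ ∧
          ∀ D : W.SelmerDualData κ γ,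
            LinearMap.ker (IwasawaAlgebra.mulTRat p D.X ∘ₗ IwasawaAlgebra.mulTRat p D.X)
              = LinearMap.ker (IwasawaAlgebra.mulTRat p D.X)) →
    ∀ (W : WeierstrassCurve ℚ) [W.IsElliptic] [W.IsGloballyMinimal],
      ∃ (p : ℕ) (_ : Fact p.Prime), 5 ≤ p ∧ IsOrdinaryAt W p ∧
        ∃ (D : WeierstrassCurve.PAdicHeightData W p), D.IsCanonical ∧
          ∃ (N : ℕ) (_ : NeZero N) (f : CuspForm (Gamma0 N) 2), IsNewformOf W f ∧
            (padicLFunction f (unitRoot W p : ℚ_[p])).order = W.mordellWeilRank := by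
  intro hmod hBCS hcontrol hA hB W _ _
  obtain ⟨B₁, hB₁⟩ := hA W
  obtain ⟨B₂, hB₂⟩ := stub_cofiniteIMC hBCS W
  obtain ⟨B₃, hB₃⟩ := stub_cofiniteTorsion hBCS W
  obtain ⟨p, hpB, hp, h5, hord, κ, γ, hκ, hγ, hγ', hss⟩ := hB W (B₁ ∪ B₂ ∪ B₃)
  simp only [Finset.mem_union, not_or] at hpB
  obtain ⟨⟨hp1, hp2⟩, hp3⟩ := hpB
  haveI : Fact p.Prime := hp
  -- the Iwasawa datum and its finite generation (tree theorems)
  obtain ⟨D⟩ := W.nonempty_selmerDualData_holds κ γ hγ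
  haveI : Module.Finite (IwasawaAlgebra p) D.X := D.module_finite_of_isCyclotomic W κ hκ hγ
  -- a generator of the (principal) characteristic ideal
  obtain ⟨fE, hfE⟩ : ∃ fE : IwasawaAlgebra p, D.charIdeal = Ideal.span {fE} := by
    have hP : (D.charIdeal).IsPrincipal := charIdeal_isPrincipal_holds p D.X
    exact ⟨hP.generator, (Ideal.span_singleton_generator D.charIdeal).symm⟩
  -- modularity
  haveI : NeZero (W.conductorNorm ℤ) := ⟨(WeierstrassCurve.conductorNorm_pos_holds (W := W)).ne'⟩
  obtain ⟨f, hf⟩ := hmod W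
  -- torsion (BCS, cofinitely), then the order computation at the semisimple prime
  have htors : D.IsTorsion := hB₃ p hp3 h5 hord κ γ hκ hγ hγ' f hf D
  have horder : fE.order = W.mordellWeilRank :=
    stub_semisimpleOrder hcontrol W p h5 hord κ γ hκ hγ D htors (hss D) (hB₁ p hp1 hord) fE hfE
  -- the main conjecture (cofinitely)
  have hL : (padicLFunction f (unitRoot W p : ℚ_[p])).order = W.mordellWeilRank := by
    rw [hB₂ p hp2 h5 hord κ γ hκ hγ hγ' D fE hfE f hf, horder]
  -- the canonical height datum (decoration of the crux)
  obtain ⟨Dh, hDh⟩ := WeierstrassCurve.exists_isCanonical_holds W p h5 hord.1 hord.2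
  exact ⟨p, hp, h5, hord, Dh, hDh, _, inferInstance, f, hf, hL⟩

end Summit.BirchSwinnertonDyer.BirchSwinnertonDyer.Cruxes.PinchPrime.FirstLayerStability

end
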